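import Literature.NumberTheory.Automorphic.GLnCentralCharacter
import Literature.NumberTheory.Automorphic.AutomorphicGLnMultiplicityOneProofs
import HarnessLib

/-!
# Smoothed cusp forms transform under the centre through the central character

Topic `NumberTheory/Automorphic`; namespace `Literature.NumberTheory.Automorphic`. Proof file (theorems
only). For a cuspidal automorphic representation `π ⊂ L²_cusp(GL_n(𝔸_K) ⧸ A_G GL_n(K))` with central
character `ω_π` (`CuspidalAutomorphicRepGL.exists_centralCharacter`, `GLnCentralCharacter`:
`R(z 1_n) f = ω_π(z) f` in `L²`) and a smoothed vector `S_η f`, `f ∈ π` (the continuous function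
`smoothedForm η f` on the automorphic quotient, `SmoothedAutomorphicForms`), the pointwise identities

* `smoothedForm_smul_of_mem_center` — `S_η f (w • x) = S_η (R(w⁻¹) f) (x)` for central `w` (the
  smoothing commutes with central translations; it does not see null modifications of `f`,
  `orbitalSmoothing_adelicHaar_congr_ae`);
* `CuspidalAutomorphicRepGL.exists_centralCharacter_smoothedForm` (**main**) — there is a unitary
  Hecke character `ω`, trivial on `A_G`, with `R(z 1_n) f = ω(z) f` on `π` and, for every weight `η`,
  every `f ∈ π`, every idele `z` and every point `x`:
  **`S_η f ((z 1_n) • x) = ω(z)⁻¹ S_η f (x)`**, hence **`‖S_η f ((z 1_n) • x)‖ = ‖S_η f (x)‖`** and,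
  for the classical left-invariant function `φ = invQuot (S_η f)` on `GL_n(𝔸_K)`,
  **`φ((z 1_n) g) = ω(z) φ(g)`** (Borel–Jacquet (1979), §4.6: cusp forms in an irreducible `π` have
  the central character of `π`).

These are the central-invariance inputs of the Rankin–Selberg unfolding on the honest quotient
(`RankinSelbergQuotientUnfolding.exists_lintegral_eisensteinLIntegral_mul_eq`, hypothesis on `F = ‖S_η f‖²`)
and of the Euler factorisation at the good places (negative valuations of the torus variable).

## References

* A. Borel, H. Jacquet, *Automorphic forms and automorphic representations*, Proc. Sympos. Pure
  Math. 33 (1979), part 1, §4.6 [BorelJacquetCorvallis1979].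
-/

noncomputable section

open MeasureTheory Measure Set Filter Topology IsDedekindDomain NumberField
open scoped ENNReal NNReal

namespace Literature.NumberTheory.Automorphic

open Literature.NumberTheory.GaloisRepresentations (ideleGroup HeckeCharacter)

section Central

variable {n : ℕ} {K : Type} [Field K] [NumberField K]
  {μ : Measure (AdelicGroupData.gl n K).automorphicQuotient}
  [(AdelicGroupData.gl n K).IsAutomorphicMeasure μ]

attribute [local instance] adelicBorel borelSpace_adelic locallyCompactSpace_adelic
  secondCountableTopology_gl_adelic

/-- **Smoothing commutes with central translations**: for `w` central in `GL_n(𝔸_K)`, an `L²`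
automorphic form `f`, a weight `η` and a point `x`,
`S_η f (w • x) = S_η (R(w⁻¹) f) (x)` — `∫ η(g) f(g⁻¹ w • x) dg = ∫ η(g) (R(w⁻¹) f)(g⁻¹ • x) dg` because
`g⁻¹ w = w g⁻¹` and `R(w⁻¹) f = f(w • ·)` a.e., null modifications being invisible to the smoothing
(`orbitalSmoothing_adelicHaar_congr_ae`). [folklore] -/
theorem smoothedForm_smul_of_mem_center (η : (AdelicGroupData.gl n K).Adelic → ℝ)
    (f : (AdelicGroupData.gl n K).L2 μ) {w : (AdelicGroupData.gl n K).Adelic}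
    (hw : w ∈ Subgroup.center (AdelicGroupData.gl n K).Adelic)
    (x : (AdelicGroupData.gl n K).automorphicQuotient) :
    smoothedForm η f (w • x) = smoothedForm η ((AdelicGroupData.gl n K).rightRegular μ w⁻¹ f) x := by
  unfold smoothedForm
  rw [orbitalSmoothing_adelicHaar_congr_ae (μ := μ) (fun g => (η g : ℂ))
    (AdelicGroupData.rightRegular_apply_coeFn (AdelicGroupData.gl n K) μ w⁻¹ f) x]
  unfold orbitalSmoothing
  refine integral_congr_ae (Eventually.of_forall fun g => ?_)
  simp only [inv_inv, smul_smul]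
  rw [(Subgroup.mem_center_iff.1 hw g⁻¹)]

/-- **Smoothed cusp forms transform under the centre through the central character.** For a cuspidal
automorphic representation `π` of `GL_n(𝔸_K)` there is a unitary Hecke character `ω = ω_π`, trivial on
`A_G`, with `R(z 1_n) f = ω(z) f` for `f ∈ π` (`CuspidalAutomorphicRepGL.exists_centralCharacter`), such
that for every weight `η`, every `f ∈ π`, every `z ∈ 𝔸_Kˣ`:
`S_η f ((z 1_n) • x) = ω(z)⁻¹ S_η f (x)` for all `x`, `‖S_η f ((z 1_n) • x)‖ = ‖S_η f (x)‖`, and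
`invQuot (S_η f) ((z 1_n) g) = ω(z) invQuot (S_η f) (g)` for all `g ∈ GL_n(𝔸_K)`
(Borel–Jacquet (1979), §4.6). [cite: BorelJacquetCorvallis1979, §4.6 and 5.7] -/
theorem CuspidalAutomorphicRepGL.exists_centralCharacter_smoothedForm (P : CuspidalAutomorphicRepGL n K μ) :
    ∃ ω : HeckeCharacter K, ω.IsUnitary ∧ (∀ t : ℝ≥0ˣ, ω (posRealIdele K t) = 1) ∧
      (∀ (z : ideleGroup K) (f : P.1.toSubmodule),
        P.1.toContRep (Matrix.GeneralLinearGroup.scalar (Fin n) z) f = ((ω z : ℂˣ) : ℂ) • f) ∧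
      (∀ (η : (AdelicGroupData.gl n K).Adelic → ℝ) (f : P.1.toSubmodule) (z : ideleGroup K)
        (g : GL (Fin n) (AdeleRing (𝓞 K) K)),
        smoothedForm η (f : (AdelicGroupData.gl n K).L2 μ)
            ((AdelicGroupData.gl n K).toAutomorphicQuotient (Matrix.GeneralLinearGroup.scalar (Fin n) z * g)) =
          (((ω z : ℂˣ) : ℂ))⁻¹ * smoothedForm η (f : (AdelicGroupData.gl n K).L2 μ)
            ((AdelicGroupData.gl n K).toAutomorphicQuotient g)) ∧
      (∀ (η : (AdelicGroupData.gl n K).Adelic → ℝ) (f : P.1.toSubmodule) (z : ideleGroup K)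
        (g : GL (Fin n) (AdeleRing (𝓞 K) K)),
        ‖smoothedForm η (f : (AdelicGroupData.gl n K).L2 μ)
            ((AdelicGroupData.gl n K).toAutomorphicQuotient (Matrix.GeneralLinearGroup.scalar (Fin n) z * g))‖ =
          ‖smoothedForm η (f : (AdelicGroupData.gl n K).L2 μ) ((AdelicGroupData.gl n K).toAutomorphicQuotient g)‖) ∧
      ∀ (η : (AdelicGroupData.gl n K).Adelic → ℝ) (f : P.1.toSubmodule) (z : ideleGroup K)
        (g : GL (Fin n) (AdeleRing (𝓞 K) K)),
        invQuot (AdelicGroupData.gl n K) (smoothedForm η (f : (AdelicGroupData.gl n K).L2 μ))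
            (Matrix.GeneralLinearGroup.scalar (Fin n) z * g) =
          ((ω z : ℂˣ) : ℂ) * invQuot (AdelicGroupData.gl n K) (smoothedForm η (f : (AdelicGroupData.gl n K).L2 μ)) g := by
  obtain ⟨ω, hu, hA, hact, -, -⟩ := P.exists_centralCharacter
  set sc : ideleGroup K →* (AdelicGroupData.gl n K).Adelic := Matrix.GeneralLinearGroup.scalar (Fin n) with hsc
  -- the pointwise transformation law of the smoothed form
  have key : ∀ (η : (AdelicGroupData.gl n K).Adelic → ℝ) (f : P.1.toSubmodule) (z : ideleGroup K)
      (x : (AdelicGroupData.gl n K).automorphicQuotient),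
      smoothedForm η (f : (AdelicGroupData.gl n K).L2 μ) (sc z • x) =
        (((ω z : ℂˣ) : ℂ))⁻¹ * smoothedForm η (f : (AdelicGroupData.gl n K).L2 μ) x := by
    intro η f z x
    have hw : sc z ∈ Subgroup.center (AdelicGroupData.gl n K).Adelic := generalLinearGroup_scalar_mem_center z
    rw [smoothedForm_smul_of_mem_center η _ hw x]
    -- `R((z 1_n)⁻¹) f = ω(z⁻¹) • f` in `L²`
    have hL2 : (AdelicGroupData.gl n K).rightRegular μ (sc z)⁻¹ (f : (AdelicGroupData.gl n K).L2 μ) =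
        ((ω z⁻¹ : ℂˣ) : ℂ) • (f : (AdelicGroupData.gl n K).L2 μ) := by
      have h := congrArg Subtype.val (hact z⁻¹ f)
      rw [ContRepresentation.ClosedSubrep.coe_toContRep_apply, Submodule.coe_smul] at h
      rw [← map_inv]
      exact h
    rw [hL2, smoothedForm_const_smul, map_inv, Units.val_inv_eq_inv_val]
  -- the same at the points `π g`, `g ∈ GL_n(𝔸_K)`
  have key' : ∀ (η : (AdelicGroupData.gl n K).Adelic → ℝ) (f : P.1.toSubmodule) (z : ideleGroup K)
      (g : (AdelicGroupData.gl n K).Adelic),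
      smoothedForm η (f : (AdelicGroupData.gl n K).L2 μ) ((AdelicGroupData.gl n K).toAutomorphicQuotient (sc z * g)) =
        (((ω z : ℂˣ) : ℂ))⁻¹ * smoothedForm η (f : (AdelicGroupData.gl n K).L2 μ)
          ((AdelicGroupData.gl n K).toAutomorphicQuotient g) := by
    intro η f z g
    rw [← AdelicGroupData.smul_toAutomorphicQuotient]
    exact key η f z _
  -- the classical function
  have key'' : ∀ (η : (AdelicGroupData.gl n K).Adelic → ℝ) (f : P.1.toSubmodule) (z : ideleGroup K)
      (g : (AdelicGroupData.gl n K).Adelic),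
      invQuot (AdelicGroupData.gl n K) (smoothedForm η (f : (AdelicGroupData.gl n K).L2 μ)) (sc z * g) =
        ((ω z : ℂˣ) : ℂ) * invQuot (AdelicGroupData.gl n K) (smoothedForm η (f : (AdelicGroupData.gl n K).L2 μ)) g := by
    intro η f z g
    -- `invQuot F ((z 1_n) g) = F(π(g⁻¹ (z 1_n)⁻¹)) = F(π((z⁻¹ 1_n) g⁻¹)) = ω(z⁻¹)⁻¹ F(π g⁻¹)`
    rw [invQuot_apply, invQuot_apply, mul_inv_rev]
    have hcomm : g⁻¹ * (sc z)⁻¹ = (sc z)⁻¹ * g⁻¹ := by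
      rw [← map_inv]
      exact (Subgroup.mem_center_iff.1 (generalLinearGroup_scalar_mem_center z⁻¹) g⁻¹)
    rw [hcomm, ← map_inv, key', map_inv, Units.val_inv_eq_inv_val, inv_inv]
  refine ⟨ω, hu, hA, hact, fun η f z g => key' η f z g, fun η f z g => ?_, fun η f z g => key'' η f z g⟩
  have h := key' η f z g
  exact (congrArg (fun w : ℂ => ‖w‖) h).trans (by rw [norm_mul, norm_inv, hu z, inv_one, one_mul])

end Central

end Literature.NumberTheory.Automorphic
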